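import Summits.BirchSwinnertonDyer.Rank1Residual.Additive.ChiBranchInputOdd
import Summits.BirchSwinnertonDyer.Rank1Residual.Additive.ChiBranchConstantTerm
import Summits.BirchSwinnertonDyer.Rank1Residual.EisensteinPrimes
import HarnessLib

/-!
# The LOWER half at an additive prime, semistable-twist locus: the Skinner–Urban direction on the
# `χ_p`-branch of the twist, TYPED (cell `b2b-bsdres`, team n1011, seat p07, row T-N10-low)

HONEST FRAMING (cell `b2b-bsdres`, run/shared/lean/b2b/bsd-rank1-residual/, verbatim in every
file): the goal of the cell is to DELETE the COMBINATION-SHAPED residual classes of the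
Birch–Swinnerton-Dyer formula for ALL analytic-rank `≤ 1` elliptic curves over `ℚ` — "full BSD
formula for every rank `≤ 1` curve in class `C`" assembled STRICTLY from published theorems — so
that the rank-`≤ 1` remainder becomes exactly the CONSTRUCTION-SHAPED classes, which are TYPED
(missing-input `Prop`s), NOT attempted. This is not "finishing BSD". Team n1011 (RESIDUAL-MAP §I
N10 / N11): prove what is provable now; shrink each hard class to its core with data; no claim
beyond stated classes. Research route on the CONSTRUCTION-SHAPED item N10 (X3 ∪ X4, `r = 0`, the
LOWER half `ord_p #Ш_an ≤ ord_p #Ш` at an additive prime); N10 stays CONSTRUCTION; nothing is booked;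
no label moves. Three `def`s (typed inputs, NOTHING asserted), their unfolding lemmas, and one
bookkeeping theorem; no named fact is minted.

## What and why

On the semistable-twist locus (`E = E♭ ⊗ χ_{p*}`, `E♭ = V` good ordinary — Kodaira `I₀*` — or
multiplicative — `I_n*` — at the odd prime `p`) the additive sub-cell typed the Kato / Euler-system
direction of the `χ_p = ω^{(p−1)/2}`-branch of the Iwasawa main conjecture of `E♭`, transported to
`X(E/ℚ_∞)` by the classical prime-to-`p` descent [C] (`X(E/ℚ_∞) ≅ X(E♭/ℚ(μ_{p^∞}))^{(χ_p)}`,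
Greenberg LNM 1716 §5): `ChiBranchDivisibilityAt` / `ChiBranchLeadingTermAt` (additive-p4,
`ChiBranchInput.lean`; odd branch `ChiBranchLeadingTermOddAt`) — SOME `g ∈ char_Λ X(E/ℚ_∞)` IS
`ϖ·L_p(f♭, α, ω^{(p−1)/2}, T)`, resp. has constant term `u·ϖ·∑_{a mod p}(a/p)[a/p]^±_{f♭}` — and
discharged it from Kato 2004 Thm. 17.4 / Wuthrich 2014 Thm. 16 on the component; it yields the
UPPER half of `BSD(E,p)` in rank `0`. What is missing for N10 on this locus is the OPPOSITE
containment. This file types it, in the same vocabulary, so that a future theorem of the published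
record (the direction Skinner–Urban, Invent. Math. 195 (2014) Thm. 3.6.4 prove on the TRIVIAL
component `ω^0` only — "Remarks on the hypotheses (i)", p. 43; announced for `g ⊗ χ_K`, `p ∣ d_K`,
`p ∤ 6N_g` by Burungale–Skinner–Tian–Wan, arXiv:2409.01350) plugs in by modus ponens:

* `ChiBranchLowerDivisibilityAt W p` (Λ-adic, INTEGRAL, good ordinary twist, `p ≡ 1 (mod 4)`):
  for every semistable-twist datum `(V, C, f, ϖ, κ, γ, D)` as in `ChiBranchDivisibilityAt`, EVERY
  `g ∈ char_Λ X(W/ℚ_∞)` is a `Λ`-multiple of `ϖ · L_p(f, α, ω^{(p−1)/2}, T)` in `ℚ_p⟦T⟧`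
  (`char X ⊆ (ϖ·L_br)·Λ`): the ∀/integral twin of additive-p4's ∃-statement;
* `ChiBranchLowerLeadingTermAt W p` (`T = 0`, good ordinary OR multiplicative twist,
  `p ≡ 1 (mod 4)`): EVERY `g ∈ char_Λ X(W/ℚ_∞)` has `g(0) ∈ (ϖ·∑_{a mod p}(a/p)[a/p]⁺_f)·ℤ_p`;
* `ChiBranchLowerLeadingTermOddAt W p` (`T = 0`, `p ≡ 3 (mod 4)`, `p = 3` included; twist by
  `−p = p*`, minus symbols and `Ω⁻`): the odd twin.
No image hypothesis and no `ℓ_p`-factor appear (a lower-bound source carries its own hypotheses on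
`(W, p)`, which belong to the consumer; `ℓ_p(E)·#H¹(ℚ_{∞,p}/ℚ_p, E)` is a `p`-adic unit on this
locus: Delbourgo 1998 §2.2 Lemma (ii) for `I_n*`, additive-p2's reading note in
`GordCycLeadingTerm.lean` for `I₀*`).
* `chiBranchLowerLeadingTermAt_of_divisibility_of_padicValRat_j_nonneg`: on a potentially GOOD `W`
  (`0 ≤ ord_p j`) the Λ-adic input implies the `T = 0` input — the constant term of the branch is
  `α⁻¹·∑(a/p)[a/p]⁺_f` (tree theorem `constantCoeff_padicLFunctionBranch_half`, Mazur–Tate–Teitelbaum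
  §I.14 + Euler's criterion, `α ∈ ℤ_p^×`), and a multiplicative twist datum cannot occur
  (`ord_p j(W) = ord_p j(V) < 0`).

CONSUMERS (sequel `ChiBranchLowerTransport.lean`, filed after team row T-N10b's cyclotomic-level
input `CycLeadingTermDvdAt` lands): `ChiBranchLowerLeadingTerm[Odd]At W p ↔ CycLeadingTermDvdAt W p`
by Birch's formula and Pal's period theorem (`entireLFunction_one_eq_of_twist[_neg]`:
`L(E,1) = ±ϖ·(∑…)·Ω_E`), whence `MissingLowerBoundAt W p` on the (M) rows through the exact
Delbourgo Prop. 4 (T-N10b). HONEST NOTE (CLASS-CLOSURE-PLAN §3.1 E3): `L(E,1)` and `L(E♭,1)` are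
values of `E♭`'s measure at DIFFERENT characters (`χ_p` resp. `1`); nothing here transports a
statement about `E♭` over `ℚ_∞` (the `ω^0`-component, where Skinner–Urban applies) to `E` — the
typed inputs live on the `ω^{(p−1)/2}`-component, for which no lower-bound theorem is in print at
any additive pair (RESIDUAL-MAP §I N10; harvest-2 E65; additive-p4 REPAIR-CENSUS gen 11/14).

References: Skinner–Urban 2014 [SkinnerUrban2014] Cor. 3.6.3, Thm. 3.6.4 and Remarks (i) (pp. 42–43);
Mazur–Tate–Teitelbaum 1986 [MazurTateTeitelbaum1986Invent] §I.13–I.14; Greenberg 1999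
[GreenbergLNM1716] §5; Wuthrich 2014 [Wuthrich2014] Thm. 16 (shape); Delbourgo 1998 [Delbourgo1998]
§2.2 Lemma, Prop. 4, Main Conjecture p. 151; Burungale–Skinner–Tian–Wan arXiv:2409.01350 (announced).
-/

noncomputable section

open scoped Classical MatrixGroups ModularForm

open CongruenceSubgroup WeierstrassCurve Literature.NumberTheory.EllipticCurves
  Literature.NumberTheory.EllipticCurves.ModularForms
  Literature.NumberTheory.EllipticCurves.Rank1Residual

namespace Summit.BirchSwinnertonDyer.Rank1Residual.Additive

/-! ### The typed inputs (LOWER direction) -/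

/-- **The Skinner–Urban containment on the `χ_p`-branch, Λ-adic and INTEGRAL, TYPED** (good
ordinary twist, `p ≡ 1 (mod 4)`). For the additive curve `E = W` (globally minimal) at `p`: whenever
`W` is `ℚ`-isomorphic to the quadratic twist by `p` of a globally minimal `V` GOOD ORDINARY at `p`,
`f` is the newform of `V`, `κ`/`γ` the cyclotomic `ℤ_p`-extension of `ℚ` with a topological
generator matching the cyclotomic variable, `D` a Pontryagin-dual datum of `Sel_{p^∞}(W/ℚ_∞)` and
`ϖ·Ω_V = Ω⁺_f`, EVERY `g ∈ char_Λ X(W/ℚ_∞)` is, in `ℚ_p⟦T⟧`, a `Λ`-multiple of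
`ϖ · L_p(f, α, ω^{(p−1)/2}, T)` (`padicLFunctionBranch f α (p/2)`, `α = unitRoot V p`):
`char_Λ X(W/ℚ_∞) ⊆ (ϖ·L_p(f, α, ω^{(p−1)/2}, T))·Λ` — the main-conjecture containment "`Ch ⊆ (𝓛)`"
of Skinner–Urban 2014 (Cor. 3.6.3 / Thm. 3.6.4 shape) on the `ω^{(p−1)/2}`-COMPONENT of `E♭ = V`,
transported to `E` by the prime-to-`p` descent [C]. The ∀/integral twin of additive-p4's
`ChiBranchDivisibilityAt`. A predicate on `(W, p)`; NOT in print at any additive pair; its universal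
closure is NOT asserted. [cite: SkinnerUrban2014, Thm. 3.6.4 (p. 43) (shape only; nothing asserted)]
[cite: GreenbergLNM1716, §5 (PDF p. 143) (shape only; nothing asserted)] -/
def ChiBranchLowerDivisibilityAt (W : WeierstrassCurve ℚ) (p : ℕ) [Fact p.Prime] : Prop :=
  ∀ (V : WeierstrassCurve ℚ) [V.IsElliptic] [V.IsGloballyMinimal]
    {κ : ZpExtension ℚ p} {γ : Field.absoluteGaloisGroup ℚ} {N : ℕ} [NeZero N]
    {f : CuspForm (Gamma0 N) 2},
    p % 4 = 1 →
    (∃ C : VariableChange ℚ, C • V.quadraticTwist (p : ℚ) = W) →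
    GoodOrd V p →
    κ.IsCyclotomic → κ.IsTopGenerator γ → IsCyclotomicVariable p γ → IsNewformOf V f →
    ∀ (D : W.SelmerDualData κ γ) (ϖ : ℚ), (ϖ : ℝ) * V.realPeriodRat = plusPeriod f →
      ∀ g ∈ D.charIdeal, ∃ h : IwasawaAlgebra p,
        iwasawaToPowerSeries p g =
          iwasawaToPowerSeries p h *
            (PowerSeries.C ((ϖ : ℚ) : ℚ_[p]) * padicLFunctionBranch f (unitRoot V p : ℚ_[p]) (p / 2))

/-- **The Skinner–Urban direction on the `χ_p`-branch at `T = 0`, TYPED** (`p ≡ 1 (mod 4)`, good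
ordinary OR multiplicative twist). In the setting of `ChiBranchLeadingTermAt` (additive-p4) — `W`
`ℚ`-isomorphic to the twist by `p` of a globally minimal `V` good ordinary or multiplicative at `p`,
newform `f`, `ϖ·Ω_V = Ω⁺_f`, cyclotomic `κ`/`γ`, dual datum `D` of `Sel_{p^∞}(W/ℚ_∞)` — EVERY
`g ∈ char_Λ X(W/ℚ_∞)` has constant term `g(0) = h · ϖ · ∑_{a mod p} (a/p)[a/p]⁺_f` for some
`h ∈ ℤ_p`: the `T = 0` specialisation of "`char X(E/ℚ_∞) ⊆` (the `χ_p`-branch of `L_p(E♭)`)"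
(value at `T = 0` by Mazur–Tate–Teitelbaum §I.14: `α⁻¹·∑_a χ_p(a)[a/p]⁺`, `α` the unit root resp.
`a_p(E♭) = ±1`, a `p`-adic unit absorbed in `h`). The ∀-twin of additive-p4's `ChiBranchLeadingTermAt`
(which has SOME `g` with `g(0) = u·ϖ·∑…`, `u ∈ ℤ_p^×`). No image hypothesis, no `ℓ_p`-factor. A
predicate on `(W, p)`; NOT in print at any additive pair; its universal closure is NOT asserted.
[cite: SkinnerUrban2014, Thm. 3.6.4 (p. 43) (shape only; nothing asserted)]
[cite: MazurTateTeitelbaum1986Invent, §I.14 (shape only; nothing asserted)] -/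
def ChiBranchLowerLeadingTermAt (W : WeierstrassCurve ℚ) (p : ℕ) [Fact p.Prime] : Prop :=
  ∀ (V : WeierstrassCurve ℚ) [V.IsElliptic] [V.IsGloballyMinimal]
    {κ : ZpExtension ℚ p} {γ : Field.absoluteGaloisGroup ℚ} {N : ℕ} [NeZero N]
    {f : CuspForm (Gamma0 N) 2},
    p % 4 = 1 →
    (∃ C : VariableChange ℚ, C • V.quadraticTwist (p : ℚ) = W) →
    (GoodOrd V p ∨ Mult V p) →
    κ.IsCyclotomic → κ.IsTopGenerator γ → IsCyclotomicVariable p γ → IsNewformOf V f →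
    ∀ (D : W.SelmerDualData κ γ) (ϖ : ℚ), (ϖ : ℝ) * V.realPeriodRat = plusPeriod f →
      ∀ g ∈ D.charIdeal, ∃ h : ℤ_[p],
        ((PowerSeries.constantCoeff g : ℤ_[p]) : ℚ_[p]) =
          (h : ℚ_[p]) * (ϖ : ℚ_[p]) * (legendrePlusSymbolSum f p : ℚ_[p])

/-- **The Skinner–Urban direction on the `χ_{−p}`-branch at `T = 0`, ODD branch (`p ≡ 3 (mod 4)`,
`p = 3` included), TYPED.** In the setting of `ChiBranchLeadingTermOddAt` (additive-p4) — `W`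
`ℚ`-isomorphic to the twist by `−p = p*` of a globally minimal `V` good ordinary or multiplicative
at `p`, newform `f`, `ϖ⁻·|Ω⁻(V)| = Ω⁻_f` (`V.imaginaryPeriodRat`, `minusPeriod f`), cyclotomic
`κ`/`γ`, dual datum `D` of `Sel_{p^∞}(W/ℚ_∞)` — EVERY `g ∈ char_Λ X(W/ℚ_∞)` has constant term
`g(0) = h · ϖ⁻ · ∑_{a mod p} (a/p)[a/p]⁻_f` for some `h ∈ ℤ_p`. Odd twin of
`ChiBranchLowerLeadingTermAt`; the ∀-twin of `ChiBranchLeadingTermOddAt`. No image hypothesis, no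
`ℓ_p`-factor. A predicate on `(W, p)`; NOT in print; its universal closure is NOT asserted.
[cite: SkinnerUrban2014, Thm. 3.6.4 (p. 43) (shape only; nothing asserted)]
[cite: MazurTateTeitelbaum1986Invent, §I.14 (shape only; nothing asserted)] -/
def ChiBranchLowerLeadingTermOddAt (W : WeierstrassCurve ℚ) (p : ℕ) [Fact p.Prime] : Prop :=
  ∀ (V : WeierstrassCurve ℚ) [V.IsElliptic] [V.IsGloballyMinimal]
    {κ : ZpExtension ℚ p} {γ : Field.absoluteGaloisGroup ℚ} {N : ℕ} [NeZero N]
    {f : CuspForm (Gamma0 N) 2},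
    p % 4 = 3 →
    (∃ C : VariableChange ℚ, C • V.quadraticTwist (-(p : ℚ)) = W) →
    (GoodOrd V p ∨ Mult V p) →
    κ.IsCyclotomic → κ.IsTopGenerator γ → IsCyclotomicVariable p γ → IsNewformOf V f →
    ∀ (D : W.SelmerDualData κ γ) (ϖ : ℚ), (ϖ : ℝ) * V.imaginaryPeriodRat = minusPeriod f →
      ∀ g ∈ D.charIdeal, ∃ h : ℤ_[p],
        ((PowerSeries.constantCoeff g : ℤ_[p]) : ℚ_[p]) =
          (h : ℚ_[p]) * (ϖ : ℚ_[p]) * (legendreMinusSymbolSum f p : ℚ_[p])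

/-- Unfolding lemma for `ChiBranchLowerDivisibilityAt` (to apply the predicate as a function). -/
theorem chiBranchLowerDivisibilityAt_iff (W : WeierstrassCurve ℚ) (p : ℕ) [Fact p.Prime] :
    ChiBranchLowerDivisibilityAt W p ↔
      ∀ (V : WeierstrassCurve ℚ) [V.IsElliptic] [V.IsGloballyMinimal]
        {κ : ZpExtension ℚ p} {γ : Field.absoluteGaloisGroup ℚ} {N : ℕ} [NeZero N]
        {f : CuspForm (Gamma0 N) 2},
        p % 4 = 1 →
        (∃ C : VariableChange ℚ, C • V.quadraticTwist (p : ℚ) = W) →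
        GoodOrd V p →
        κ.IsCyclotomic → κ.IsTopGenerator γ → IsCyclotomicVariable p γ → IsNewformOf V f →
        ∀ (D : W.SelmerDualData κ γ) (ϖ : ℚ), (ϖ : ℝ) * V.realPeriodRat = plusPeriod f →
          ∀ g ∈ D.charIdeal, ∃ h : IwasawaAlgebra p,
            iwasawaToPowerSeries p g =
              iwasawaToPowerSeries p h *
                (PowerSeries.C ((ϖ : ℚ) : ℚ_[p]) *
                  padicLFunctionBranch f (unitRoot V p : ℚ_[p]) (p / 2)) :=
  Iff.rfl

/-- Unfolding lemma for `ChiBranchLowerLeadingTermAt` (to apply the predicate as a function). -/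
theorem chiBranchLowerLeadingTermAt_iff (W : WeierstrassCurve ℚ) (p : ℕ) [Fact p.Prime] :
    ChiBranchLowerLeadingTermAt W p ↔
      ∀ (V : WeierstrassCurve ℚ) [V.IsElliptic] [V.IsGloballyMinimal]
        {κ : ZpExtension ℚ p} {γ : Field.absoluteGaloisGroup ℚ} {N : ℕ} [NeZero N]
        {f : CuspForm (Gamma0 N) 2},
        p % 4 = 1 →
        (∃ C : VariableChange ℚ, C • V.quadraticTwist (p : ℚ) = W) →
        (GoodOrd V p ∨ Mult V p) →
        κ.IsCyclotomic → κ.IsTopGenerator γ → IsCyclotomicVariable p γ → IsNewformOf V f →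
        ∀ (D : W.SelmerDualData κ γ) (ϖ : ℚ), (ϖ : ℝ) * V.realPeriodRat = plusPeriod f →
          ∀ g ∈ D.charIdeal, ∃ h : ℤ_[p],
            ((PowerSeries.constantCoeff g : ℤ_[p]) : ℚ_[p]) =
              (h : ℚ_[p]) * (ϖ : ℚ_[p]) * (legendrePlusSymbolSum f p : ℚ_[p]) :=
  Iff.rfl

/-- Unfolding lemma for `ChiBranchLowerLeadingTermOddAt` (to apply the predicate as a function). -/
theorem chiBranchLowerLeadingTermOddAt_iff (W : WeierstrassCurve ℚ) (p : ℕ) [Fact p.Prime] :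
    ChiBranchLowerLeadingTermOddAt W p ↔
      ∀ (V : WeierstrassCurve ℚ) [V.IsElliptic] [V.IsGloballyMinimal]
        {κ : ZpExtension ℚ p} {γ : Field.absoluteGaloisGroup ℚ} {N : ℕ} [NeZero N]
        {f : CuspForm (Gamma0 N) 2},
        p % 4 = 3 →
        (∃ C : VariableChange ℚ, C • V.quadraticTwist (-(p : ℚ)) = W) →
        (GoodOrd V p ∨ Mult V p) →
        κ.IsCyclotomic → κ.IsTopGenerator γ → IsCyclotomicVariable p γ → IsNewformOf V f →
        ∀ (D : W.SelmerDualData κ γ) (ϖ : ℚ), (ϖ : ℝ) * V.imaginaryPeriodRat = minusPeriod f →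
          ∀ g ∈ D.charIdeal, ∃ h : ℤ_[p],
            ((PowerSeries.constantCoeff g : ℤ_[p]) : ℚ_[p]) =
              (h : ℚ_[p]) * (ϖ : ℚ_[p]) * (legendreMinusSymbolSum f p : ℚ_[p]) :=
  Iff.rfl

/-! ### The Λ-adic input implies the `T = 0` input on a potentially good curve -/

variable (p : ℕ) [hp : Fact p.Prime]

/-- **Constant terms: `ι g = ι h · (ϖ · L_p(f, α, ω^{(p−1)/2}, T))` gives
`g(0) = (h(0)·α⁻¹) · ϖ · ∑_{a mod p}(a/p)[a/p]⁺_f` with `h(0)·α⁻¹ ∈ ℤ_p`** (good ordinary `V`, `p`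
odd): the branch constant term is `α⁻¹·∑(a/p)[a/p]⁺_f` (tree theorem
`constantCoeff_padicLFunctionBranch_half`, Mazur–Tate–Teitelbaum §I.14 + Euler's criterion) and
`α = unitRoot V p ∈ ℤ_p^×` (`unitRoot_spec_holds`). [cite: MazurTateTeitelbaum1986Invent, §I.14] -/
theorem exists_padicInt_constantCoeff_eq_of_iwasawaToPowerSeries_eq_mul_branch (hp2 : p ≠ 2)
    {N : ℕ} [NeZero N] {f : CuspForm (Gamma0 N) 2} (V : WeierstrassCurve ℚ) [V.IsElliptic]
    [V.IsGloballyMinimal] (hord : IsOrdinaryAt V p) (hf : IsNewformOf V f)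
    {g h : IwasawaAlgebra p} {ϖ : ℚ}
    (hg : iwasawaToPowerSeries p g =
      iwasawaToPowerSeries p h *
        (PowerSeries.C ((ϖ : ℚ) : ℚ_[p]) * padicLFunctionBranch f (unitRoot V p : ℚ_[p]) (p / 2))) :
    ∃ h₀ : ℤ_[p], ((PowerSeries.constantCoeff g : ℤ_[p]) : ℚ_[p]) =
      (h₀ : ℚ_[p]) * (ϖ : ℚ_[p]) * (legendrePlusSymbolSum f p : ℚ_[p]) := by
  obtain ⟨-, hunit⟩ := unitRoot_spec_holds V p hord
  set u : ℤ_[p]ˣ := hunit.unit with hu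
  have hcoe : ((u : ℤ_[p]) : ℚ_[p]) = (unitRoot V p : ℚ_[p]) := by rw [hu, IsUnit.unit_spec]
  have hinv : (((u⁻¹ : ℤ_[p]ˣ) : ℤ_[p]) : ℚ_[p]) = (unitRoot V p : ℚ_[p])⁻¹ := by
    rw [← hcoe]
    refine eq_inv_of_mul_eq_one_left ?_
    rw [← PadicInt.coe_mul, Units.inv_mul, PadicInt.coe_one]
  refine ⟨PowerSeries.constantCoeff h * ((u⁻¹ : ℤ_[p]ˣ) : ℤ_[p]), ?_⟩
  have h0 := congrArg PowerSeries.constantCoeff hg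
  rw [map_mul, map_mul, PowerSeries.constantCoeff_C,
    constantCoeff_padicLFunctionBranch_half p hp2 V hord hf,
    constantCoeff_iwasawaToPowerSeries, constantCoeff_iwasawaToPowerSeries] at h0
  rw [h0, PadicInt.coe_mul, hinv]
  ring

/-- **On a potentially GOOD additive curve the Λ-adic LOWER input implies the `T = 0` LOWER input**:
`ChiBranchLowerDivisibilityAt W p → ChiBranchLowerLeadingTermAt W p` when `0 ≤ ord_p j(W)`. A good
ordinary twist datum is handled by the constant-term computation above; a MULTIPLICATIVE twist datum
`V` cannot occur, since `ord_p j(W) = ord_p j(V) < 0` for it (`j` is a twist invariant,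
`j_quadraticTwist`; `EisensteinPrimes.padicValRat_j_neg_of_mult`).
[cite: MazurTateTeitelbaum1986Invent, §I.14] -/
theorem chiBranchLowerLeadingTermAt_of_divisibility_of_padicValRat_j_nonneg
    (W : WeierstrassCurve ℚ) [W.IsElliptic] (hj : 0 ≤ padicValRat p W.j)
    (hBC : ChiBranchLowerDivisibilityAt W p) : ChiBranchLowerLeadingTermAt W p := by
  intro V _ _ κ γ N _ f hp4 hVW hV hκ hγ hγ' hf D ϖ hϖ g hgmem
  have hp2 : p ≠ 2 := by omega
  rcases hV with hord | hmult
  · obtain ⟨h, hgh⟩ := hBC V hp4 hVW hord hκ hγ hγ' hf D ϖ hϖ g hgmem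
    exact exists_padicInt_constantCoeff_eq_of_iwasawaToPowerSeries_eq_mul_branch p hp2 V hord hf hgh
  · exfalso
    have hp0 : (p : ℚ) ≠ 0 := by exact_mod_cast hp.out.ne_zero
    obtain ⟨C, hC⟩ := hVW
    haveI := V.isElliptic_quadraticTwist (d := (p : ℚ)) hp0
    have hjV : W.j = V.j := by
      subst hC
      rw [variableChange_j, V.j_quadraticTwist hp0]
    have hneg := EisensteinPrimes.padicValRat_j_neg_of_mult V p hmult
    rw [← hjV] at hneg
    exact absurd hj (not_le.mpr hneg)

end Summit.BirchSwinnertonDyer.Rank1Residual.Additive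

end
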